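import Mathlib
import HarnessLib

/-!
# Crux `UVSeamRec` (stmt-QuantumFields-20043): Hubbard–Stratonovich press-button for the QUADRATIC carrier —
# joint exponential moments of squares from an extensive sub-Gaussian LINEAR-source bound

Helper file (`--supports stmt-QuantumFields-20043`) of the LEAD seat `ym-spine-20043-p1` (gen 8).  Context: the registered
v5(α) stub `BirthV5A.stub_responseMomentsOdd6 : UV → (RM)` has the documented discharge architecture (β)
(p535725 `TemperedResponse.responseMoments_of_quadratic_and_polymerLaw`, p539259 `…Odd6_of_quadratic_and_polymerLaw`):
(split) + (EM_Q) «doubled joint exponential moments of a quadratic carrier `Q`» + (PL).  This file reduces (EM_Q) for a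
carrier of the form `Q = λ·ℓ²` (square of a LINEAR flux statistic `ℓ`, e.g. the harmonic-extension curvature at the cube
centre in units `(βR⁴)^{1/2}`) to the canonical output of a convergent expansion — an EXTENSIVE SUB-GAUSSIAN bound on the
generating function in LINEAR local sources,
`(EM_lin)  ∫ exp(Σ_{i∈T} t_i ℓ_i) dμ ≤ exp(m·Σ|t_i| + (v/2)·Σ t_i²)`  for all real source vectors `t`,
via the Hubbard–Stratonovich identity `exp(λ s²) = E_g exp(√(2λ) s g)` (`g` standard normal), Fubini, and the one-dimensional
Gaussian integral `E exp(c|g| + a g²) ≤ 2(1−2a)^{-1/2} exp(c²/(2(1−2a)))`.  Result: `∫ exp(λ Σ_{i∈T} ℓ_i²) dμ ≤ e^{B·#T}` with the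
EXPLICIT `e^{B} = 2 (1 − 2λv)^{-1/2} exp(λ m²/(1 − 2λv))` (`2λv < 1`), uniformly in everything else — the ℓ²-structure
`Σ t_i²` of (EM_lin) is exactly the operator-norm (almost-orthogonality) input located by ceilings-p2 (note #54 §2: ℓ¹/Gershgorin
budgets diverge like `log(L/R)` for dipole influence in `d = 4`).

* §1 `integral_exp_mul_add_mul_sq_gaussianReal`, `integral_exp_mul_abs_add_mul_sq_gaussianReal_le` — the 1-d Gaussian integrals.
* §2 `integral_exp_sum_mul_gaussianPi` (HS identity), `integral_exp_mul_sum_sq_le_of_subGaussianLinear` (abstract theorem,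
  any finite measure, any finite index type, bounded measurable statistics).

The route-currency press-buttons ((EM_Q) ⇐ (EM_lin) at `torusE`, and the composition BY NAME with the registered stub body) are in
the sequel `…CeilingsSubGaussianCarrierUnit.lean`.

HONEST FRAMING: a model-free probabilistic tool; (EM_lin) for the Wilson state at weak coupling is OPEN (it is the
Gaussian-domination half of E0′-K); nothing of E0′ is proved here; not a gap, not Clay.

References: Hubbard–Stratonovich linearisation and sub-Gaussian ⇒ sub-exponential squares are folklore
(e.g. Vershynin, *High-Dimensional Probability* (2018) Lemma 2.7.6 / Prop. 2.5.2); the (β) architecture: p535725, p539259.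
-/

set_option autoImplicit false

noncomputable section

open MeasureTheory ProbabilityTheory Finset

namespace Summit.QuantumFields.YangMills.Cruxes.UVSeamRec.TemperedResponse

/-! ## §1 One-dimensional Gaussian integrals -/

section OneDim

/-- `∫ exp(c x + a x²) dN(0,1)(x) = (1 − 2a)^{-1/2} · exp(c²/(2(1 − 2a)))` for `a < 1/2` (complete the square). [folklore] -/
theorem integral_exp_mul_add_mul_sq_gaussianReal {a : ℝ} (ha : a < 1 / 2) (c : ℝ) :
    ∫ x, Real.exp (c * x + a * x ^ 2) ∂(gaussianReal 0 1) =
      Real.sqrt (1 / (1 - 2 * a)) * Real.exp (c ^ 2 / (2 * (1 - 2 * a))) := by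
  rw [integral_gaussianReal_eq_integral_smul (by norm_num)]
  simp only [gaussianPDFReal, smul_eq_mul, sub_zero, NNReal.coe_one, mul_one]
  set k : ℝ := (1 - 2 * a) / 2 with hk
  have hk0 : 0 < k := by rw [hk]; linarith
  set x₀ : ℝ := c / (2 * k) with hx₀
  have e : ∀ x : ℝ, (√(2 * Real.pi))⁻¹ * Real.exp (-x ^ 2 / 2) * Real.exp (c * x + a * x ^ 2)
      = (√(2 * Real.pi))⁻¹ * Real.exp (c ^ 2 / (4 * k)) * Real.exp (-k * (x - x₀) ^ 2) := by
    intro x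
    rw [mul_assoc, mul_assoc, ← Real.exp_add, ← Real.exp_add]
    congr 2
    rw [hx₀]
    field_simp
    rw [hk]
    ring
  simp_rw [e, integral_const_mul]
  rw [integral_sub_right_eq_self (μ := (volume : Measure ℝ)) (fun x => Real.exp (-k * x ^ 2)) x₀,
    integral_gaussian]
  have h2a : 0 < 1 - 2 * a := by linarith
  have hck : c ^ 2 / (4 * k) = c ^ 2 / (2 * (1 - 2 * a)) := by rw [hk]; field_simp; ring
  rw [hck, mul_right_comm]
  congr 1
  have hπ : 0 < Real.pi := Real.pi_pos
  rw [← Real.sqrt_inv, ← Real.sqrt_mul (by positivity)]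
  congr 1
  rw [hk]
  field_simp

/-- `∫ exp(c |x| + a x²) dN(0,1)(x) ≤ 2 (1 − 2a)^{-1/2} exp(c²/(2(1 − 2a)))` for `a < 1/2` (split `e^{c|x|} ≤ e^{cx} + e^{−cx}`).
[folklore] -/
theorem integral_exp_mul_abs_add_mul_sq_gaussianReal_le {a : ℝ} (ha : a < 1 / 2) (c : ℝ) :
    ∫ x, Real.exp (c * |x| + a * x ^ 2) ∂(gaussianReal 0 1) ≤
      2 * (Real.sqrt (1 / (1 - 2 * a)) * Real.exp (c ^ 2 / (2 * (1 - 2 * a)))) := by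
  have h2a : 0 < 1 - 2 * a := by linarith
  have hval : ∀ c' : ℝ, ∫ x, Real.exp (c' * x + a * x ^ 2) ∂(gaussianReal 0 1) =
      Real.sqrt (1 / (1 - 2 * a)) * Real.exp (c' ^ 2 / (2 * (1 - 2 * a))) :=
    fun c' => integral_exp_mul_add_mul_sq_gaussianReal ha c'
  have hpos : 0 < Real.sqrt (1 / (1 - 2 * a)) * Real.exp (c ^ 2 / (2 * (1 - 2 * a))) := by positivity
  -- integrability of the two exponential tilts (their integrals are nonzero)
  have hint : ∀ c' : ℝ, Integrable (fun x => Real.exp (c' * x + a * x ^ 2)) (gaussianReal 0 1) := by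
    intro c'
    by_contra h
    have h0 := integral_undef h
    rw [hval c'] at h0
    have : 0 < Real.sqrt (1 / (1 - 2 * a)) * Real.exp (c' ^ 2 / (2 * (1 - 2 * a))) := by positivity
    exact this.ne' h0
  have hle : ∀ x : ℝ, Real.exp (c * |x| + a * x ^ 2) ≤
      Real.exp (c * x + a * x ^ 2) + Real.exp (-c * x + a * x ^ 2) := by
    intro x
    rcases le_or_gt 0 x with hx | hx
    · rw [abs_of_nonneg hx]
      linarith [Real.exp_pos (-c * x + a * x ^ 2)]
    · rw [abs_of_neg hx]
      have : c * -x = -c * x := by ring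
      rw [this]
      linarith [Real.exp_pos (c * x + a * x ^ 2)]
  calc ∫ x, Real.exp (c * |x| + a * x ^ 2) ∂(gaussianReal 0 1)
      ≤ ∫ x, (Real.exp (c * x + a * x ^ 2) + Real.exp (-c * x + a * x ^ 2)) ∂(gaussianReal 0 1) :=
        integral_mono_of_nonneg (Filter.Eventually.of_forall fun x => (Real.exp_pos _).le)
          ((hint c).add (hint (-c))) (Filter.Eventually.of_forall hle)
    _ = 2 * (Real.sqrt (1 / (1 - 2 * a)) * Real.exp (c ^ 2 / (2 * (1 - 2 * a)))) := by
        rw [integral_add (hint c) (hint (-c)), hval c, hval (-c), neg_sq]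
        ring

/-- Integrability of `exp(c |x| + a x²)` under `N(0,1)` for `a < 1/2`. [folklore] -/
theorem integrable_exp_mul_abs_add_mul_sq_gaussianReal {a : ℝ} (ha : a < 1 / 2) (c : ℝ) :
    Integrable (fun x => Real.exp (c * |x| + a * x ^ 2)) (gaussianReal 0 1) := by
  have h2a : 0 < 1 - 2 * a := by linarith
  have hint : ∀ c' : ℝ, Integrable (fun x => Real.exp (c' * x + a * x ^ 2)) (gaussianReal 0 1) := by
    intro c'
    by_contra h
    have h0 := integral_undef h
    rw [integral_exp_mul_add_mul_sq_gaussianReal ha c'] at h0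
    have : 0 < Real.sqrt (1 / (1 - 2 * a)) * Real.exp (c' ^ 2 / (2 * (1 - 2 * a))) := by positivity
    exact this.ne' h0
  refine ((hint c).add (hint (-c))).mono' (by fun_prop) (Filter.Eventually.of_forall fun x => ?_)
  rw [Real.norm_eq_abs, abs_of_pos (Real.exp_pos _), Pi.add_apply]
  rcases le_or_gt 0 x with hx | hx
  · rw [abs_of_nonneg hx]
    linarith [Real.exp_pos (-c * x + a * x ^ 2)]
  · rw [abs_of_neg hx]
    have : c * -x = -c * x := by ring
    rw [this]
    linarith [Real.exp_pos (c * x + a * x ^ 2)]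

end OneDim

/-! ## §2 Hubbard–Stratonovich: exponential moments of squares from a sub-Gaussian linear-source bound -/

section HS

variable {ι : Type*} [Fintype ι]

/-- **Hubbard–Stratonovich identity** for the product standard Gaussian on `ι → ℝ`:
`∫ exp(Σ_i s_i g_i) dN(0,1)^{⊗ι}(g) = exp(Σ_i s_i²/2)`. [folklore] -/
theorem integral_exp_sum_mul_gaussianPi (s : ι → ℝ) :
    ∫ g, Real.exp (∑ i, s i * g i) ∂(Measure.pi fun _ : ι => gaussianReal 0 1) =
      Real.exp (∑ i, (s i) ^ 2 / 2) := by
  simp_rw [Real.exp_sum]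
  rw [integral_fintype_prod_eq_prod (f := fun i x => Real.exp (s i * x))]
  refine Finset.prod_congr rfl fun i _ => ?_
  have h := congrFun (mgf_fun_id_gaussianReal (μ := (0 : ℝ)) (v := (1 : NNReal))) (s i)
  simp only [mgf, zero_mul, zero_add, NNReal.coe_one, one_mul] at h
  simpa [mul_comm] using h

/-- Integrability of `g ↦ exp(Σ_i (c_i |g_i| + a g_i²))` under the product standard Gaussian, `a < 1/2`. [folklore] -/
theorem integrable_exp_sum_abs_gaussianPi {a : ℝ} (ha : a < 1 / 2) (c : ι → ℝ) :
    Integrable (fun g : ι → ℝ => Real.exp (∑ i, (c i * |g i| + a * (g i) ^ 2)))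
      (Measure.pi fun _ : ι => gaussianReal 0 1) := by
  simp_rw [Real.exp_sum]
  exact Integrable.fintype_prod (f := fun i x => Real.exp (c i * |x| + a * x ^ 2))
    (fun i => integrable_exp_mul_abs_add_mul_sq_gaussianReal ha (c i))

/-- **Exponential moments of a sum of squares from an extensive sub-Gaussian linear-source bound** (Hubbard–Stratonovich).
Let `μ` be a finite measure, `ℓ_i` (`i ∈ ι`, finite) bounded measurable real statistics, reals `m, v` and `λ ≥ 0` with `2λv < 1`, and
suppose the generating function in LINEAR sources obeys `∫ exp(Σ_i t_i ℓ_i) dμ ≤ exp(m Σ_i |t_i| + (v/2) Σ_i t_i²)` for every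
`t : ι → ℝ`.  Then `∫ exp(λ Σ_i ℓ_i²) dμ ≤ (2 (1 − 2λv)^{-1/2} exp(λ m²/(1 − 2λv)))^{#ι}`.
Proof: `exp(λΣℓ_i²) = E_g exp(√(2λ)Σ g_iℓ_i)` (HS), Fubini, the hypothesis at `t_i = √(2λ) g_i`, and the 1-d bound
`E exp(m√(2λ)|g| + λv g²) ≤ 2(1−2λv)^{-1/2}exp(λm²/(1−2λv))` coordinatewise. [folklore] -/
theorem integral_exp_mul_sum_sq_le_of_subGaussianLinear {Ω : Type*} [MeasurableSpace Ω] (μ : Measure Ω)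
    [IsFiniteMeasure μ] (ℓ : ι → Ω → ℝ) (hℓm : ∀ i, Measurable (ℓ i)) {M : ℝ} (hℓb : ∀ i ω, |ℓ i ω| ≤ M)
    {m v lam : ℝ} (hlam : 0 ≤ lam) (h2 : 2 * lam * v < 1)
    (hlin : ∀ t : ι → ℝ, ∫ ω, Real.exp (∑ i, t i * ℓ i ω) ∂μ ≤
      Real.exp (m * ∑ i, |t i| + v / 2 * ∑ i, (t i) ^ 2)) :
    ∫ ω, Real.exp (lam * ∑ i, (ℓ i ω) ^ 2) ∂μ ≤
      (2 * (Real.sqrt (1 / (1 - 2 * (lam * v))) * Real.exp (lam * m ^ 2 / (1 - 2 * (lam * v))))) ^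
        Fintype.card ι := by
  set ν : Measure (ι → ℝ) := Measure.pi fun _ : ι => gaussianReal 0 1 with hν
  set c : ℝ := Real.sqrt (2 * lam) with hc
  have hc0 : 0 ≤ c := Real.sqrt_nonneg _
  have hcsq : c ^ 2 = 2 * lam := Real.sq_sqrt (by positivity)
  have hlv : lam * v < 1 / 2 := by nlinarith
  -- the HS integrand on the product space
  set F : Ω → (ι → ℝ) → ℝ := fun ω g => Real.exp (∑ i, (c * ℓ i ω) * g i) with hF
  -- (1) pointwise HS identity
  have hHS : ∀ ω, Real.exp (lam * ∑ i, (ℓ i ω) ^ 2) = ∫ g, F ω g ∂ν := by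
    intro ω
    rw [hF, hν, integral_exp_sum_mul_gaussianPi]
    congr 1
    rw [Finset.mul_sum]
    refine Finset.sum_congr rfl fun i _ => ?_
    rw [mul_pow, hcsq]; ring
  -- (2) domination of F by an integrable function of g alone, and integrability on the product
  set H : (ι → ℝ) → ℝ := fun g => Real.exp (∑ i, (c * M * |g i| + 0 * (g i) ^ 2)) with hH
  have hHint : Integrable H ν := by
    rw [hH, hν]; exact integrable_exp_sum_abs_gaussianPi (by norm_num) (fun _ => c * M)
  have hFm : Measurable (Function.uncurry F) := by
    refine Real.measurable_exp.comp (Finset.measurable_sum _ fun i _ => ?_)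
    exact (measurable_const.mul ((hℓm i).comp measurable_fst)).mul ((measurable_pi_apply i).comp measurable_snd)
  have hFle : ∀ ω g, ‖F ω g‖ ≤ H g := by
    intro ω g
    rw [Real.norm_eq_abs, abs_of_pos (Real.exp_pos _), hH]
    refine Real.exp_le_exp.2 (Finset.sum_le_sum fun i _ => ?_)
    have h1 : c * ℓ i ω * g i ≤ |c * ℓ i ω * g i| := le_abs_self _
    rw [abs_mul, abs_mul, abs_of_nonneg hc0] at h1
    have h2 : c * |ℓ i ω| * |g i| ≤ c * M * |g i| :=
      mul_le_mul_of_nonneg_right (mul_le_mul_of_nonneg_left (hℓb i ω) hc0) (abs_nonneg _)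
    linarith
  have hFint : Integrable (Function.uncurry F) (μ.prod ν) := by
    refine Integrable.mono' ((integrable_const (1 : ℝ)).mul_prod hHint) hFm.aestronglyMeasurable
      (Filter.Eventually.of_forall fun p => ?_)
    rw [one_mul]
    exact hFle p.1 p.2
  -- (3) Fubini
  have hswap : ∫ ω, Real.exp (lam * ∑ i, (ℓ i ω) ^ 2) ∂μ = ∫ g, ∫ ω, F ω g ∂μ ∂ν := by
    rw [← integral_integral_swap hFint]
    exact integral_congr_ae (Filter.Eventually.of_forall hHS)
  -- (4) the linear-source bound at t = c • g
  set B : (ι → ℝ) → ℝ := fun g => Real.exp (∑ i, (m * c * |g i| + lam * v * (g i) ^ 2)) with hB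
  have hinner : ∀ g, ∫ ω, F ω g ∂μ ≤ B g := by
    intro g
    have h := hlin fun i => c * g i
    have hF' : ∀ ω, F ω g = Real.exp (∑ i, (c * g i) * ℓ i ω) := by
      intro ω
      simp only [hF]
      exact congrArg Real.exp (Finset.sum_congr rfl fun i _ => by ring)
    simp_rw [hF'] at *
    refine h.trans (le_of_eq ?_)
    rw [hB]
    congr 1
    rw [Finset.mul_sum, Finset.mul_sum, ← Finset.sum_add_distrib]
    refine Finset.sum_congr rfl fun i _ => ?_
    rw [abs_mul, abs_of_nonneg hc0, mul_pow, hcsq]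
    ring
  have hBint : Integrable B ν := by
    rw [hB, hν]; exact integrable_exp_sum_abs_gaussianPi hlv (fun _ => m * c)
  -- (5) integrate in g: product structure and the 1-d bound
  have hBval : ∫ g, B g ∂ν ≤
      (2 * (Real.sqrt (1 / (1 - 2 * (lam * v))) * Real.exp (lam * m ^ 2 / (1 - 2 * (lam * v))))) ^
        Fintype.card ι := by
    rw [hB, hν]
    simp_rw [Real.exp_sum]
    rw [integral_fintype_prod_eq_prod (f := fun i x => Real.exp (m * c * |x| + lam * v * x ^ 2)),
      ← Finset.card_univ, ← Finset.prod_const]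
    refine Finset.prod_le_prod (fun i _ => integral_nonneg fun x => (Real.exp_pos _).le) fun i _ => ?_
    have h1 := integral_exp_mul_abs_add_mul_sq_gaussianReal_le hlv (m * c)
    have hmc : (m * c) ^ 2 / (2 * (1 - 2 * (lam * v))) = lam * m ^ 2 / (1 - 2 * (lam * v)) := by
      rw [mul_pow, hcsq]
      have : (1 - 2 * (lam * v)) ≠ 0 := by linarith
      field_simp
    rw [hmc] at h1
    exact h1
  -- (6) assemble
  calc ∫ ω, Real.exp (lam * ∑ i, (ℓ i ω) ^ 2) ∂μ = ∫ g, ∫ ω, F ω g ∂μ ∂ν := hswap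
    _ ≤ ∫ g, B g ∂ν := integral_mono hFint.integral_prod_right hBint hinner
    _ ≤ _ := hBval

end HS

end Summit.QuantumFields.YangMills.Cruxes.UVSeamRec.TemperedResponse

end
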